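import Summits.QuantumFields.YangMills.Theorems.LuscherReductionRunningReductionTraceFormula
import Summits.QuantumFields.YangMills.Theorems.LuscherReductionRunningReductionLatticeTopLower
import Summits.QuantumFields.YangMills.Theorems.LuscherReductionRunningReductionCoarseUpperCopies
import Summits.QuantumFields.YangMills.Theorems.FemtoTransferGapLevelsPos
import HarnessLib

/-!
# Explicit floors and exponents for the small-ball door: `Z_phys(2L) ≥ λ₀^{2L}`, `λ₀ ≥ e^{2β|E|}β^{−(8|P|+97|E|)}`, `|E| = 3L³`, `|P| ≤ 9L³`,
# and the width of the persistence strip `2L·√(2(a + 2LN + 3) log β/β) ≤ β^{−γ}` on the window `L ≤ β^a` (`γ < 1/2 − 3a`)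

Support module for the door «Laplace-window twist deficit ⇐ ONE thermal small-ball estimate» (crux `SwapTwistDeficit.TwistDeficitLaplaceWindow`,
item stmt-QuantumFields-23776, LINE g11-A of seat ym-idea-4; and the window slow bit of `SlowBitWindow.StepPersistence`, stmt-QuantumFields-23271).
Elementary real-analysis bookkeeping, every constant absorbed into a power of `β`:

* `pow_levelValue_zero_le_physTrace`, `physTrace_two_mul_pos`: `0 < λ₀^{2L} ≤ Z_phys(2L)` (trace formula);
* `levelValue_zero_ge_rpow`: for `β ≥ max(9, 4/w₀)`, `λ₀ ≥ (e^{2β})^{|E|}·β^{−(8|P|+97|E|)}` (the tree's `levelValue_zero_ge_poly` and `linkC_ge_poly`);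
* `card_edge_three`, `card_plaquette_three_le`, `exponent_le`: `N = 8|P| + 97|E| ≤ 363 L³`;
* ★ `stripWidth_le_rpow`: for `0 < a ≤ 1`, `γ < 1/2 − 3a`, eventually in `β`, uniformly in `1 ≤ L ≤ β^a`: `2L·√(2(a + 2LN + 3)·log β/β) ≤ β^{−γ}`
  (`log β ≤ β^δ/δ`); `exp_neg_le_one_sub_half`, `rpow_neg_inv_le`: `β^{−1/L} ≤ 1 − β^{−a}/2` for `L ≤ β^a`, `β ≥ e`.

HONEST FRAMING: arithmetic; no physics content beyond the cited fixed-lattice floors; nothing about infinite volume, the continuum or the Clay gap.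
No `sorry`, no new axiom, no new definition.  References: [cite: Luscher1983, §2]; [cite: MontvayMunster1994, (3.145)].
-/

set_option autoImplicit false

noncomputable section

open MeasureTheory Filter Topology Real Function
open scoped Matrix ComplexConjugate BigOperators
open Literature.MathematicalPhysics.QuantumLattice
open Literature.MathematicalPhysics.QuantumFieldTheory hiding SU2
open Summit.QuantumFields.YangMills.Theorems

namespace Summit.QuantumFields.YangMills.Theorems.FemtoTransferGap.TT

open Summit.QuantumFields.YangMills.Theorems.FemtoTransferGap

variable {L : ℕ} [NeZero L]

/-! ## §3 Explicit floors: `Z_phys(2L) ≥ λ₀^{2L}`, `λ₀ ≥ e^{2β|E|}·β^{−N}` -/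

/-- `λ₀^{2L} ≤ Z_phys(2L)` (`β ≥ 1`, `L ≥ 1`; trace formula, all levels `≥ 0`). [cite: MontvayMunster1994, (3.145)] -/
theorem pow_levelValue_zero_le_physTrace (hL : 1 ≤ L) {β : ℝ} (hβ : 1 ≤ β) :
    levelValue su2Rep L β 0 ^ (2 * L) ≤ physTrace L β (2 * L) := by
  have hβ0 : 0 < β := by linarith
  have hS := traceFormula_all L β (2 * L) hβ (by omega)
  exact le_hasSum hS 0 fun k _ => pow_nonneg (levelValue_su2Rep_pos hβ0 k).le _

/-- `0 < Z_phys(2L)` (`β ≥ 1`, `L ≥ 1`). [folklore] -/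
theorem physTrace_two_mul_pos (hL : 1 ≤ L) {β : ℝ} (hβ : 1 ≤ β) : 0 < physTrace L β (2 * L) :=
  lt_of_lt_of_le (pow_pos (levelValue_zero_su2Rep_pos L β) _) (pow_levelValue_zero_le_physTrace hL hβ)

/-- **Explicit polynomial floor for `λ₀`**: for `β ≥ max(9, 4/w₀)` (`w₀ = e^{−1/2}·8/(3π³)`),
`λ₀(β,L) ≥ (e^{2β})^{|E|} · (β^{8|P| + 97|E|})⁻¹` — the tree's floor `levelValue_zero_ge_poly` (`e^{−(8|P|+2|E|)}(5⁸(8β+1)¹⁹)^{−2|E|} c_β^{|E|} ≤ λ₀`)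
and `c_β ≥ e^{2β}w₀/(4β²)` (`linkC_ge_poly`), with every constant absorbed into a power of `β`. [cite: Luscher1983, §2] -/
theorem levelValue_zero_ge_rpow {β : ℝ} (hβ9 : 9 ≤ β)
    (hβw : 4 / (Real.exp (-(1 / 2 : ℝ)) * (8 / (3 * π ^ 3))) ≤ β) :
    Real.exp (2 * β) ^ Fintype.card (Edge 3 L) * (β ^ (8 * Fintype.card (Plaquette 3 L) + 97 * Fintype.card (Edge 3 L)))⁻¹ ≤
      levelValue su2Rep L β 0 := by
  set E : ℕ := Fintype.card (Edge 3 L) with hE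
  set P : ℕ := Fintype.card (Plaquette 3 L) with hP
  set w₀ : ℝ := Real.exp (-(1 / 2 : ℝ)) * (8 / (3 * π ^ 3)) with hw₀
  have hw₀pos : 0 < w₀ := by positivity
  have hβ1 : 1 ≤ β := by linarith
  have hβ0 : 0 < β := by linarith
  have hfloor := levelValue_zero_ge_poly (L := L) hβ1
  -- `latCE ≥ (e^{2β} w₀/(4β²))^E`
  have hlink : Real.exp (2 * β) * (w₀ / (4 * β ^ 2)) ≤ linkC β := linkC_ge_poly hβ1
  have hlink0 : 0 ≤ Real.exp (2 * β) * (w₀ / (4 * β ^ 2)) := by positivity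
  have hlat : (Real.exp (2 * β) * (w₀ / (4 * β ^ 2))) ^ E ≤ latCE L β := pow_le_pow_left₀ hlink0 hlink E
  -- (i) `e^{-(8P+2E)} ≥ β^{-(8P+2E)}` since `β ≥ e`
  have hexp1 : Real.exp 1 ≤ β := by
    have := Real.exp_one_lt_d9; linarith
  have h1 : (β ^ (8 * P + 2 * E))⁻¹ ≤ Real.exp (-(8 * (P : ℝ) + 2 * E)) := by
    have h : Real.exp 1 ^ (8 * P + 2 * E) ≤ β ^ (8 * P + 2 * E) := pow_le_pow_left₀ (Real.exp_pos _).le hexp1 _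
    have e1 : Real.exp (-(8 * (P : ℝ) + 2 * E)) = (Real.exp 1 ^ (8 * P + 2 * E))⁻¹ := by
      rw [Real.exp_one_pow, ← Real.exp_neg]; congr 1; push_cast; ring
    rw [e1]
    exact inv_anti₀ (pow_pos (Real.exp_pos _) _) h
  -- (ii) `5⁸(8β+1)^{19} ≤ β^{46}`
  have h2base : (5 : ℝ) ^ 8 * (8 * β + 1) ^ 19 ≤ β ^ 46 := by
    have h5 : (5 : ℝ) ^ 8 ≤ β ^ 8 := pow_le_pow_left₀ (by norm_num) (by linarith) 8
    have h9 : (8 * β + 1) ^ 19 ≤ (β ^ 2) ^ 19 := pow_le_pow_left₀ (by positivity) (by nlinarith) 19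
    calc (5 : ℝ) ^ 8 * (8 * β + 1) ^ 19 ≤ β ^ 8 * (β ^ 2) ^ 19 := mul_le_mul h5 h9 (by positivity) (by positivity)
      _ = β ^ 46 := by ring
  have h2 : (β ^ (92 * E))⁻¹ ≤ (((5 : ℝ) ^ 8 * (8 * β + 1) ^ 19)⁻¹) ^ (2 * E) := by
    rw [show 92 * E = 46 * (2 * E) by ring, pow_mul, ← inv_pow]
    exact pow_le_pow_left₀ (by positivity) (inv_anti₀ (by positivity) h2base) _
  -- (iii) `w₀/(4β²) ≥ β^{-3}`
  have h3base : (β ^ 3)⁻¹ ≤ w₀ / (4 * β ^ 2) := by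
    rw [div_le_iff₀ hw₀pos] at hβw
    rw [inv_eq_one_div, div_le_div_iff₀ (by positivity) (by positivity)]
    nlinarith
  have h3 : Real.exp (2 * β) ^ E * (β ^ (3 * E))⁻¹ ≤ (Real.exp (2 * β) * (w₀ / (4 * β ^ 2))) ^ E := by
    rw [mul_pow, pow_mul, ← inv_pow]
    exact mul_le_mul_of_nonneg_left (pow_le_pow_left₀ (by positivity) h3base _) (by positivity)
  -- assemble
  have hN : (β ^ (8 * P + 97 * E))⁻¹ = (β ^ (8 * P + 2 * E))⁻¹ * (β ^ (92 * E))⁻¹ * (β ^ (3 * E))⁻¹ := by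
    rw [← mul_inv, ← mul_inv, ← pow_add, ← pow_add]; congr 2; ring
  calc Real.exp (2 * β) ^ E * (β ^ (8 * P + 97 * E))⁻¹
      = (β ^ (8 * P + 2 * E))⁻¹ * (β ^ (92 * E))⁻¹ * (Real.exp (2 * β) ^ E * (β ^ (3 * E))⁻¹) := by rw [hN]; ring
    _ ≤ Real.exp (-(8 * (P : ℝ) + 2 * E)) * (((5 : ℝ) ^ 8 * (8 * β + 1) ^ 19)⁻¹) ^ (2 * E) *
          (Real.exp (2 * β) * (w₀ / (4 * β ^ 2))) ^ E := by
        refine mul_le_mul (mul_le_mul h1 h2 (by positivity) (Real.exp_pos _).le) h3 (by positivity) (by positivity)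
    _ ≤ Real.exp (-(8 * (P : ℝ) + 2 * E)) * (((5 : ℝ) ^ 8 * (8 * β + 1) ^ 19)⁻¹) ^ (2 * E) * latCE L β :=
        mul_le_mul_of_nonneg_left hlat (by positivity)
    _ ≤ levelValue su2Rep L β 0 := hfloor

/-! ## §4 The slice-count arithmetic: `|E| = 3L³`, `|P| ≤ 9L³`, and the width of the persistence strip -/

/-- `|E| = 3 L³`. [folklore] -/
theorem card_edge_three : Fintype.card (Edge 3 L) = L ^ 3 * 3 := by
  rw [Fintype.card_prod, Fintype.card_fun, ZMod.card, Fintype.card_fin]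

/-- `|P| ≤ 9 L³`. [folklore] -/
theorem card_plaquette_three_le : Fintype.card (Plaquette 3 L) ≤ L ^ 3 * 9 := by
  rw [Fintype.card_prod, Fintype.card_fun, ZMod.card, Fintype.card_fin]
  refine Nat.mul_le_mul_left _ ?_
  calc Fintype.card {p : Fin 3 × Fin 3 // p.1 < p.2} ≤ Fintype.card (Fin 3 × Fin 3) := Fintype.card_subtype_le _
    _ = 9 := by simp

/-- The exponent `N = 8|P| + 97|E|` is at most `363 L³`. [folklore] -/
theorem exponent_le : (8 * Fintype.card (Plaquette 3 L) + 97 * Fintype.card (Edge 3 L) : ℝ) ≤ 363 * (L : ℝ) ^ 3 := by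
  have h1 := card_plaquette_three_le (L := L)
  have h2 := card_edge_three (L := L)
  have h1' : (Fintype.card (Plaquette 3 L) : ℝ) ≤ (L : ℝ) ^ 3 * 9 := by exact_mod_cast h1
  have h2' : (Fintype.card (Edge 3 L) : ℝ) = (L : ℝ) ^ 3 * 3 := by exact_mod_cast h2
  rw [h2']; nlinarith [h1']

/-- **The persistence strip is polynomially thin on the window.**  For `0 < a ≤ 1` and `γ < 1/2 − 3a` there is `β₁` such that for all `β ≥ β₁` and all
`1 ≤ L ≤ β^a`: `2L · √(2(a + 2L·N + 3)·log β / β) ≤ β^{−γ}`, `N = 8|P| + 97|E|` (so the strip width is `O(L³ √(log β/β)) = O(β^{3a − 1/2 + o(1)})`).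
[folklore] -/
theorem stripWidth_le_rpow {a γ : ℝ} (ha : 0 < a) (ha1 : a ≤ 1) (hγ : γ < 1 / 2 - 3 * a) :
    ∃ β₁ : ℝ, 9 ≤ β₁ ∧ ∀ β : ℝ, β₁ ≤ β → ∀ (L : ℕ) [NeZero L], (L : ℝ) ≤ β ^ a →
      2 * (L : ℝ) * Real.sqrt (2 * (a + 2 * L * (8 * Fintype.card (Plaquette 3 L) + 97 * Fintype.card (Edge 3 L) : ℝ) + 3) * Real.log β / β) ≤
        β ^ (-γ) := by
  set δ : ℝ := 1 - 6 * a - 2 * γ with hδ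
  have hδ0 : 0 < δ := by rw [hδ]; linarith
  -- threshold: `β^{δ/2} ≥ 2·5840/δ`
  refine ⟨max 9 ((2 * 5840 / δ) ^ (2 / δ)), le_max_left _ _, fun β hβ L _ hLβ => ?_⟩
  have hβ9 : 9 ≤ β := (le_max_left _ _).trans hβ
  have hβ0 : 0 < β := by linarith
  have hβ1 : 1 ≤ β := by linarith
  have hL1 : (1 : ℝ) ≤ L := by exact_mod_cast NeZero.one_le
  have hL0 : (0 : ℝ) < L := by linarith
  have hlog0 : 0 ≤ Real.log β := Real.log_nonneg hβ1
  -- `L ≤ β^a`, hence `L^6 ≤ β^{6a}`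
  have hL6 : (L : ℝ) ^ 6 ≤ β ^ (6 * a) := by
    have h := pow_le_pow_left₀ hL0.le hLβ 6
    rwa [← Real.rpow_natCast (β ^ a) 6, ← Real.rpow_mul hβ0.le, show a * ((6 : ℕ) : ℝ) = 6 * a by push_cast; ring] at h
  -- the radicand times `4L²` is `≤ 5840 L⁶ log β / β`
  have hN := exponent_le (L := L)
  have hrad : (2 * (L : ℝ)) ^ 2 * (2 * (a + 2 * L * (8 * Fintype.card (Plaquette 3 L) + 97 * Fintype.card (Edge 3 L) : ℝ) + 3) * Real.log β / β) ≤
      5840 * β ^ (6 * a) * Real.log β / β := by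
    rw [mul_div_assoc, mul_div_assoc]
    rw [← mul_assoc]
    refine mul_le_mul_of_nonneg_right ?_ (div_nonneg hlog0 hβ0.le)
    have hL3 : (1 : ℝ) ≤ (L : ℝ) ^ 3 := one_le_pow₀ hL1
    calc (2 * (L : ℝ)) ^ 2 * (2 * (a + 2 * L * (8 * Fintype.card (Plaquette 3 L) + 97 * Fintype.card (Edge 3 L) : ℝ) + 3))
        ≤ (2 * (L : ℝ)) ^ 2 * (2 * (1 + 2 * L * (363 * (L : ℝ) ^ 3) + 3)) := by
          refine mul_le_mul_of_nonneg_left (mul_le_mul_of_nonneg_left ?_ (by norm_num)) (by positivity)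
          nlinarith [mul_le_mul_of_nonneg_left hN (by positivity : (0 : ℝ) ≤ 2 * L)]
      _ ≤ 5840 * (L : ℝ) ^ 6 := by nlinarith [hL3, pow_nonneg hL0.le 6, pow_nonneg hL0.le 2]
      _ ≤ 5840 * β ^ (6 * a) := by nlinarith [hL6]
  -- `log β ≤ β^{δ/2} / (δ/2)`
  have hlog : Real.log β ≤ β ^ (δ / 2) / (δ / 2) := Real.log_le_rpow_div hβ0.le (by positivity)
  -- `β^{δ/2} ≥ 2·5840/δ`
  have hthr : 2 * 5840 / δ ≤ β ^ (δ / 2) := by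
    have h := (le_max_right 9 ((2 * 5840 / δ) ^ (2 / δ))).trans hβ
    have h' := Real.rpow_le_rpow (by positivity) h (by positivity : (0 : ℝ) ≤ δ / 2)
    rwa [← Real.rpow_mul (by positivity), show 2 / δ * (δ / 2) = 1 by field_simp, Real.rpow_one] at h'
  -- squared comparison: `(2Lt)² ≤ β^{-2γ}`
  have hsq : (2 * (L : ℝ)) ^ 2 * (2 * (a + 2 * L * (8 * Fintype.card (Plaquette 3 L) + 97 * Fintype.card (Edge 3 L) : ℝ) + 3) * Real.log β / β) ≤
      β ^ (-(2 * γ)) := by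
    refine hrad.trans ?_
    have e1 : β ^ (-(2 * γ)) = β ^ (6 * a) * β ^ δ / β := by
      rw [← Real.rpow_add hβ0, div_eq_mul_inv, ← Real.rpow_neg_one, ← Real.rpow_add hβ0]; congr 1; rw [hδ]; ring
    rw [e1]
    refine div_le_div_of_nonneg_right ?_ hβ0.le
    have hβδ : 0 < β ^ (δ / 2) := Real.rpow_pos_of_pos hβ0 _
    have hδsq : β ^ δ = β ^ (δ / 2) * β ^ (δ / 2) := by rw [← Real.rpow_add hβ0]; congr 1; ring
    rw [hδsq]
    calc 5840 * β ^ (6 * a) * Real.log β ≤ 5840 * β ^ (6 * a) * (β ^ (δ / 2) / (δ / 2)) :=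
          mul_le_mul_of_nonneg_left hlog (by positivity)
      _ = β ^ (6 * a) * (β ^ (δ / 2) * (2 * 5840 / δ)) := by field_simp
      _ ≤ β ^ (6 * a) * (β ^ (δ / 2) * β ^ (δ / 2)) :=
          mul_le_mul_of_nonneg_left (mul_le_mul_of_nonneg_left hthr hβδ.le) (by positivity)
  -- take square roots
  have hrad0 : 0 ≤ 2 * (a + 2 * L * (8 * Fintype.card (Plaquette 3 L) + 97 * Fintype.card (Edge 3 L) : ℝ) + 3) * Real.log β / β := by
    positivity
  have hlhs : 2 * (L : ℝ) * Real.sqrt (2 * (a + 2 * L * (8 * Fintype.card (Plaquette 3 L) + 97 * Fintype.card (Edge 3 L) : ℝ) + 3) * Real.log β / β) =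
      Real.sqrt ((2 * (L : ℝ)) ^ 2 * (2 * (a + 2 * L * (8 * Fintype.card (Plaquette 3 L) + 97 * Fintype.card (Edge 3 L) : ℝ) + 3) * Real.log β / β)) := by
    rw [Real.sqrt_mul (by positivity), Real.sqrt_sq (by positivity)]
  rw [hlhs]
  have hrhs : β ^ (-γ) = Real.sqrt (β ^ (-(2 * γ))) := by
    rw [show -(2 * γ) = -γ * 2 by ring, Real.rpow_mul hβ0.le, Real.rpow_two, Real.sqrt_sq (Real.rpow_nonneg hβ0.le _)]
  rw [hrhs]
  exact Real.sqrt_le_sqrt hsq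

/-- `e^{−x} ≤ 1 − x/2` on `[0, 1]`. [folklore] -/
theorem exp_neg_le_one_sub_half {x : ℝ} (hx0 : 0 ≤ x) (hx1 : x ≤ 1) : Real.exp (-x) ≤ 1 - x / 2 := by
  have h1 : 1 + x ≤ Real.exp x := by have := Real.add_one_le_exp x; linarith
  have h2 : Real.exp (-x) = (Real.exp x)⁻¹ := Real.exp_neg x
  rw [h2, inv_le_comm₀ (Real.exp_pos x) (by linarith), inv_eq_one_div]
  refine le_trans ?_ h1
  rw [div_le_iff₀ (by linarith)]
  nlinarith

omit [NeZero L] in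
/-- The window exponent: for `β ≥ e` and `1 ≤ L ≤ β^a`: `β^{−1/L} ≤ 1 − β^{−a}/2`. [folklore] -/
theorem rpow_neg_inv_le (hL : 1 ≤ L) {β a : ℝ} (hβ : Real.exp 1 ≤ β) (hLβ : (L : ℝ) ≤ β ^ a) :
    β ^ (-(1 : ℝ) / L) ≤ 1 - β ^ (-a) / 2 := by
  have hβ0 : 0 < β := lt_of_lt_of_le (Real.exp_pos 1) hβ
  have hL0 : (0 : ℝ) < L := by exact_mod_cast hL
  have hlog1 : 1 ≤ Real.log β := by
    rw [Real.le_log_iff_exp_le hβ0]; exact hβ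
  set x : ℝ := Real.log β / L with hx
  have hx0 : 0 ≤ x := div_nonneg (by linarith) hL0.le
  have hrpow : β ^ (-(1 : ℝ) / L) = Real.exp (-x) := by
    rw [Real.rpow_def_of_pos hβ0, hx]; congr 1; field_simp
  have hβa : β ^ (-a) ≤ 1 / β ^ a := by rw [Real.rpow_neg hβ0.le, inv_eq_one_div]
  have hβa0 : 0 < β ^ a := Real.rpow_pos_of_pos hβ0 a
  rw [hrpow]
  rcases le_or_gt x 1 with hx1 | hx1
  · -- `e^{-x} ≤ 1 − x/2` and `x ≥ β^{-a}` (as `L ≤ β^a ≤ β^a log β`)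
    refine (exp_neg_le_one_sub_half hx0 hx1).trans ?_
    have hxa : β ^ (-a) ≤ x := by
      refine hβa.trans ?_
      rw [hx, div_le_div_iff₀ hβa0 hL0]
      nlinarith
    linarith
  · -- `e^{-x} ≤ e^{-1} ≤ 1/2 ≤ 1 − β^{-a}/2`
    have h1 : Real.exp (-x) ≤ Real.exp (-1) := Real.exp_le_exp.2 (by linarith)
    have h2 : Real.exp (-1) ≤ 1 / 2 := by
      rw [Real.exp_neg, inv_le_comm₀ (Real.exp_pos 1) (by norm_num)]
      have := Real.exp_one_gt_d9; norm_num at this ⊢; linarith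
    have h3 : β ^ (-a) ≤ 1 := by
      refine hβa.trans ?_
      rw [div_le_one hβa0]
      exact Real.one_le_rpow (by linarith [Real.add_one_le_exp (1 : ℝ)]) (by
        by_contra h; push Not at h
        have : β ^ a < 1 := Real.rpow_lt_one_of_one_lt_of_neg (by linarith [Real.add_one_le_exp (1 : ℝ)]) h
        linarith [hL0, (show (1 : ℝ) ≤ L by exact_mod_cast hL)])
    linarith

end Summit.QuantumFields.YangMills.Theorems.FemtoTransferGap.TT

end
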